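import Mathlib
import Summits.CriticalPhenomena.CardyFormulaZ2.Theorems.CardySelfRefinementDefs
import Literature.Probability.Percolation.FourArmGarbanShift
import Literature.Probability.Percolation.SelfRefinementMeasure
import Literature.Probability.Percolation.QuadCrossingDiscreteGluingGarban
import HarnessLib

/-!
# Stub `stub_fourArmAboveOne` of line `far-field-is-a-quarter-turn` (crux `TrivialSectorRate`,
stmt-CriticalPhenomena-10266): the ENDPOINT case `s = 1`

Along an admissible parameter path `γ` (`PathOK k γ`) the endpoint `γ 1 = (0, ½)` of the
self-refinement model `M_k(ρ, c)` is critical bond percolation on `ℤ²`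
(`selfRefinementMeasure_zero_half`: with `ρ = 0` no tuple is correlated and every edge follows its
own fair coin), and there the four-arm bound `x₄ > 1` demanded by `FourArmAboveOneAlong` is the
tree's unconditional multi-scale bound `fourArm_bound` (Garban, Appendix B of Schramm–Smirnov 2011,
Lemma B.1, proved in `FourArmGarbanHolds.lean`), transported from the origin to every centre `c` by
translation invariance (`real_fourArmTwoClustersAt`).  This file proves exactly that:
`fourArmAboveOneAlong_at_one` (registered helper of the stub `stub_fourArmAboveOne`).

Target file:
`Summits/CriticalPhenomena/CardyFormulaZ2/Theorems/CardySelfRefinementTrivialSectorRateStubFourArmAboveOneEndpoint.lean`.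
-/

noncomputable section


namespace Summit.CriticalPhenomena.CardyFormulaZ2.Theorems.CardySelfRefinement.FarField

open Set MeasureTheory
open Literature.Probability.LatticeModels Literature.Probability.Percolation
open Literature.Probability.Percolation.QuadCrossing
open Summit.CriticalPhenomena.CardyFormulaZ2.Theses.CardySelfRefinement

/-- At the endpoint `γ 1 = (0, ½)` of an admissible path the law `M_k(γ 1)` is critical bond
percolation on `ℤ²`: the route's `M k ρ c` is the tree's `selfRefinementMeasure k ρ c` (same term —
`prm`/`cfg` are the bodies of `refinementParam`/`refinementConfig` — cf. `M_eq_selfRefinementMeasure`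
in `…GradientComparabilityStubBoundaryValuesHi`), and `selfRefinementMeasure_zero_half`. -/
theorem M_apply_one_eq_bondPercolation {k : ℕ} {γ : unitInterval → ℝ × ℝ} (hγ : PathOK k γ) :
    M k (γ 1).1 (γ 1).2 = bondPercolation (zdGraph 2) half := by
  rw [hγ.2.2.1]
  exact selfRefinementMeasure_zero_half k

/-- **Four arms above one at the endpoint `s = 1`** (registered helper of the stub
`stub_fourArmAboveOne`, line `far-field-is-a-quarter-turn`): at `γ 1 = (0, ½)` the model is
critical bond-`ℤ²` and `M_k(γ 1)(fourArmTwoClustersAt c r R) ≤ C (r/R)^{1+ε}` for all centres `c`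
and all `1 ≤ r ≤ R`, by the tree's unconditional `fourArm_bound` and translation invariance
`real_fourArmTwoClustersAt`.  (Stated for every `k`: the endpoint identity does not use the route's
range `k = 2 ∨ k = 3`.) -/
theorem fourArmAboveOneAlong_at_one {k : ℕ} {γ : unitInterval → ℝ × ℝ} (hγ : PathOK k γ) :
    ∃ ε C : ℝ, 0 < ε ∧ ∀ (c : Site 2) (r R : ℕ), 1 ≤ r → r ≤ R →
      (M k (γ 1).1 (γ 1).2).real (fourArmTwoClustersAt c r R) ≤ C * ((r : ℝ) / R) ^ (1 + ε) := by
  obtain ⟨C, ε, -, hε, h⟩ := fourArm_bound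
  refine ⟨ε, C, hε, fun c r R hr hrR => ?_⟩
  rw [M_apply_one_eq_bondPercolation hγ, real_fourArmTwoClustersAt]
  exact h r R hr hrR

end Summit.CriticalPhenomena.CardyFormulaZ2.Theorems.CardySelfRefinement.FarField

end
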